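import Literature.NumberTheory.Rogawski1990.AdelicWeightedOrbitalEulerG
import Literature.NumberTheory.Rogawski1990.AdelicInnerTransferStHalfSemisimple
import HarnessLib

/-!
# The WEIGHT-PARAMETRIC singular st-half of the inner-form transfer identity:
# `Σ_{c ∈ 𝒞′_𝐀(γ₀)} w′(c) Φ_𝐀(c; ofLocalAdelic mG mGi; T) = Σ_{c ∈ 𝒞_𝐀(γ₀)} w(c) Φ_𝐀(c; ofLocalAdelic mq mqi; T′)` at a split semisimple class
(Rogawski (1990), §14.2 (14.2.1) p. 232, §14.5 Lemma 14.5.2 (b) pp. 238–239, §4.1 (4.1.2) p. 40, §5.4 (5.4.3) pp. 72–73; Kottwitz (1986), Prop. 7.1, Cor. 7.3)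

Topic `NumberTheory/Rogawski1990`; namespace `Literature.NumberTheory.Rogawski1990`; **THEOREMS ONLY** (no definition, no named fact, no instance, no
notation, no `sorry`).  Cell `pub/hodgecm-mathlib`, ENGINE T1 (crux H413 = `stmt-HodgeConjecture-24833`), row O7 «singular semisimple classes», piece
**(SA-st-w) §4–§5** (O7 OWNER WORDS #24–#27; F0P3a-plan RULING #116 «Kottwitz signs», ref1 R1-162b∕c).  WHY: ★ (SA-st) p820520
`adelicStableOrbitalSum_classesSelf_eq_adelicStableOrbitalIntegralG_of_mul_sub_eq_zero` matched the UNSIGNED adelic stable sums of `G′ = U(H)` and `G = U(Φ₃)`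
from an UNSIGNED archimedean equation `harch`; at a split-singular class print's identity [(14.2.1) + (4.1.2)] is between the SIGNED stable orbital integrals
`Σ e(γ′) Φ(γ′, ·)`, and the unsigned archimedean equation is refuted (ref1 W19: the pair `(a′, a) = (0, g)`).  In the tree's currency «signed» = weight-parametric
(★ `adelicKappaOrbitalSum 𝒞 w m f`), so the st-half the T1b-sing closer consumes (A-p16's `SingularStableHalfSigned E′ E`) is the identity below at
`w′ := kottwitzSignWeight L 3 H`, `w := kottwitzSignWeight L 3 Φ₃` (★-pending `KottwitzSignCM`, A-p18).  This file proves it for ABSTRACT class weights that are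
EULER on the two carriers, MATCH along the local identifications `ψ_v` (`hwψ`, = «`ψ_v` preserves Kottwitz signs», F0P3a-p04's unipotent criterion under the
family pin (vii-c) «`ψ_v` is matrix conjugation»), and satisfy the WEIGHTED archimedean equation `harchW` (= the signed pin `PinSingularArchInnerTransfer` ∕ the
(ST-∞) clause of `SingularEllipticTransfer`).  Proof = ★ (ζ3) glue `adelicStableOrbitalSum_classesSelf_eq_adelicStableOrbitalIntegralG_of_forall_eq` on the
CLASS-WEIGHTED functions `(w ∘ [·]) · T.eval`, Euler forms by parts I–II, finite places by the weighted (ζ2) of §4.  HC_CM is proved only modulo the printed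
citations until rung 0 closes; this file consumes none of them.

* §4 **`localStableOrbitalIntegral_classWeight_base_eq_of_loc_eq_comp_symm`** — weighted (14.2.1) at a finite place for the transported pair;
* §5 **`adelicKappaOrbitalSum_classesSelf_eq_adelicKappaOrbitalIntegralG_of_mul_sub_eq_zero`** — the head.

## References
* [Rogawski1990] J. D. Rogawski, *Automorphic Representations of Unitary Groups in Three Variables*, Ann. of Math. Stud. 123 (1990), §4.1 (4.1.1)–(4.1.2)
  pp. 39–40, §4.3 p. 44, §5.4 (5.4.3) pp. 72–73, §14.2 (14.2.1) p. 232, §14.5 Lemma 14.5.2 (b) pp. 238–239.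
* [Kottwitz1986] R. E. Kottwitz, *Stable trace formula: elliptic singular terms*, Math. Ann. 275 (1986), 365–399, Prop. 7.1, Cor. 7.3, §9.
* [Gelbart1975] S. Gelbart, *Automorphic Forms on Adele Groups*, Ann. of Math. Stud. 83 (1975), §10 pp. 154–155.
-/

set_option autoImplicit false

noncomputable section

open MeasureTheory NumberField IsDedekindDomain Topology Function Filter
open scoped Matrix MatrixGroups

namespace Literature.NumberTheory.Rogawski1990

open Literature.NumberTheory.Automorphic Literature.MeasureTheory.Group Literature.LinearAlgebra.Matrix
open Literature.AlgebraicGeometry.ShimuraVarieties (unitaryGroup)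

/-! ## §4 Weighted (ζ2): transport of a WEIGHTED local stable sum along a weight-preserving `ψ_v` -/

section TransportW

variable {L : Type} [Field L] [NumberField L] [IsCMField L] {H : Matrix (Fin 3) (Fin 3) L}
  {γ₀ : (UnitaryGroup.cmDatum L 3 H).Rational}
  {γ : (UnitaryGroup.cmDatum L 3 (Matrix.of fun i j : Fin 3 => if i.val + j.val + 1 = 3 then (1 : L) else 0)).Rational}
  [∀ (v : HeightOneSpectrum (𝓞 ↥(maximalRealSubfield L))) (x : (UnitaryGroup.cmDatum L 3 H).Local v),
    MeasurableSpace ((UnitaryGroup.cmDatum L 3 H).Local v ⧸ Subgroup.centralizer ({x} : Set ((UnitaryGroup.cmDatum L 3 H).Local v)))]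
  [∀ (v : HeightOneSpectrum (𝓞 ↥(maximalRealSubfield L))) (x : (UnitaryGroup.cmDatum L 3 H).Local v),
    BorelSpace ((UnitaryGroup.cmDatum L 3 H).Local v ⧸ Subgroup.centralizer ({x} : Set ((UnitaryGroup.cmDatum L 3 H).Local v)))]
  [∀ (v : HeightOneSpectrum (𝓞 ↥(maximalRealSubfield L)))
    (x : (UnitaryGroup.cmDatum L 3 (Matrix.of fun i j : Fin 3 => if i.val + j.val + 1 = 3 then (1 : L) else 0)).Local v),
    MeasurableSpace ((UnitaryGroup.cmDatum L 3 (Matrix.of fun i j : Fin 3 => if i.val + j.val + 1 = 3 then (1 : L) else 0)).Local v ⧸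
      Subgroup.centralizer ({x} : Set ((UnitaryGroup.cmDatum L 3 (Matrix.of fun i j : Fin 3 => if i.val + j.val + 1 = 3 then (1 : L) else 0)).Local v)))]
  [∀ (v : HeightOneSpectrum (𝓞 ↥(maximalRealSubfield L)))
    (x : (UnitaryGroup.cmDatum L 3 (Matrix.of fun i j : Fin 3 => if i.val + j.val + 1 = 3 then (1 : L) else 0)).Local v),
    BorelSpace ((UnitaryGroup.cmDatum L 3 (Matrix.of fun i j : Fin 3 => if i.val + j.val + 1 = 3 then (1 : L) else 0)).Local v ⧸
      Subgroup.centralizer ({x} : Set ((UnitaryGroup.cmDatum L 3 (Matrix.of fun i j : Fin 3 => if i.val + j.val + 1 = 3 then (1 : L) else 0)).Local v)))]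

/-- **Weighted (14.2.1) at a finite place for the TRANSPORTED pair**: if `ψ_v` is class-preserving, `m_v = (ψ_v)_* m′_v`, `f_v = f′_v ∘ ψ_v⁻¹`,
`γ₀ ↔ γ`, and the local class weights MATCH along `ψ_v` (`w_v[ψ_v x] = w′_v[x]`, e.g. the Kottwitz signs along a matrix conjugation), then
`Σ_{x ∼ (γ₀)_v} w′_v[x] Φ′_v(x, f′_v; m′_v) = Σ_{y ∼ γ_v} w_v[y] Φ_v(y, f_v; m_v)` — ★ (ζ2) `localStableOrbitalIntegral_base_eq_of_loc_eq_comp_symm`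
applied to the class-weighted functions. [cite: Rogawski1990, §14.2 (14.2.1) p. 232; §4.1 (4.1.2) p. 40] -/
theorem localStableOrbitalIntegral_classWeight_base_eq_of_loc_eq_comp_symm (v : HeightOneSpectrum (𝓞 ↥(maximalRealSubfield L)))
    (ψ : (UnitaryGroup.cmDatum L 3 H).Local v ≃ₜ* (UnitaryGroup.cmDatum L 3 (Matrix.of fun i j : Fin 3 => if i.val + j.val + 1 = 3 then (1 : L) else 0)).Local v)
    (hcl : ∀ γ', Corresponds (UnitaryGroup.conjLocal L (IsCMField.complexConj L) v)
      ((UnitaryGroup.adelicForm L 3 H).map (UnitaryGroup.adeleToLocal L v))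
      ((UnitaryGroup.adelicForm L 3 (Matrix.of fun i j : Fin 3 => if i.val + j.val + 1 = 3 then (1 : L) else 0)).map (UnitaryGroup.adeleToLocal L v)) γ' (ψ γ'))
    (m' : OrbitalMeasureFamily ((UnitaryGroup.cmDatum L 3 H).Local v)) {f' : (UnitaryGroup.cmDatum L 3 H).Local v → ℂ}
    {f : (UnitaryGroup.cmDatum L 3 (Matrix.of fun i j : Fin 3 => if i.val + j.val + 1 = 3 then (1 : L) else 0)).Local v → ℂ}
    (hf : f = f' ∘ ψ.symm)
    (hγ : Corresponds (cmConjRingHom L) H (Matrix.of fun i j : Fin 3 => if i.val + j.val + 1 = 3 then (1 : L) else 0) γ₀ γ)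
    (wloc' : ConjClasses ((UnitaryGroup.cmDatum L 3 H).Local v) → ℂ)
    (wloc : ConjClasses ((UnitaryGroup.cmDatum L 3 (Matrix.of fun i j : Fin 3 => if i.val + j.val + 1 = 3 then (1 : L) else 0)).Local v) → ℂ)
    (hwψ : ∀ x, wloc (ConjClasses.mk (ψ x)) = wloc' (ConjClasses.mk x)) :
    localStableOrbitalIntegral L 3 H v m' (fun x => wloc' (ConjClasses.mk x) * f' x)
        ((UnitaryGroup.cmDatum L 3 H).toLocal v ((UnitaryGroup.cmDatum L 3 H).toAdelic γ₀)) =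
      localStableOrbitalIntegral L 3 (Matrix.of fun i j : Fin 3 => if i.val + j.val + 1 = 3 then (1 : L) else 0) v
        (m'.transport ψ.toMulEquiv ψ.continuous ψ.symm.continuous) (fun y => wloc (ConjClasses.mk y) * f y)
        ((UnitaryGroup.cmDatum L 3 (Matrix.of fun i j : Fin 3 => if i.val + j.val + 1 = 3 then (1 : L) else 0)).toLocal v
          ((UnitaryGroup.cmDatum L 3 (Matrix.of fun i j : Fin 3 => if i.val + j.val + 1 = 3 then (1 : L) else 0)).toAdelic γ)) := by
  refine localStableOrbitalIntegral_base_eq_of_loc_eq_comp_symm v ψ hcl m' (funext fun y => ?_) hγ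
  show wloc (ConjClasses.mk y) * f y = wloc' (ConjClasses.mk (ψ.symm y)) * f' (ψ.symm y)
  rw [hf, ← hwψ (ψ.symm y), ContinuousMulEquiv.apply_symm_apply]
  rfl

end TransportW

/-! ## §5 The weight-parametric singular st-half -/

section StHalfW


variable {L : Type} [Field L] [NumberField L] [IsCMField L] {H : Matrix (Fin 3) (Fin 3) L}
  {γ₀ : (UnitaryGroup.cmDatum L 3 H).Rational} {γ : (UnitaryGroup.cmDatum L 3 (Matrix.of fun i j : Fin 3 => if i.val + j.val + 1 = 3 then (1 : L) else 0)).Rational}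

variable
  [∀ (v : HeightOneSpectrum (𝓞 ↥(maximalRealSubfield L))) (x : (UnitaryGroup.cmDatum L 3 H).Local v),
    MeasurableSpace ((UnitaryGroup.cmDatum L 3 H).Local v ⧸ Subgroup.centralizer ({x} : Set ((UnitaryGroup.cmDatum L 3 H).Local v)))]
  [∀ (v : HeightOneSpectrum (𝓞 ↥(maximalRealSubfield L))) (x : (UnitaryGroup.cmDatum L 3 H).Local v),
    BorelSpace ((UnitaryGroup.cmDatum L 3 H).Local v ⧸ Subgroup.centralizer ({x} : Set ((UnitaryGroup.cmDatum L 3 H).Local v)))]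
  [∀ (v : HeightOneSpectrum (𝓞 ↥(maximalRealSubfield L))) (x : (UnitaryGroup.cmDatum L 3 (Matrix.of fun i j : Fin 3 => if i.val + j.val + 1 = 3 then (1 : L) else 0)).Local v),
    MeasurableSpace ((UnitaryGroup.cmDatum L 3 (Matrix.of fun i j : Fin 3 => if i.val + j.val + 1 = 3 then (1 : L) else 0)).Local v ⧸
      Subgroup.centralizer ({x} : Set ((UnitaryGroup.cmDatum L 3 (Matrix.of fun i j : Fin 3 => if i.val + j.val + 1 = 3 then (1 : L) else 0)).Local v)))]
  [∀ (v : HeightOneSpectrum (𝓞 ↥(maximalRealSubfield L))) (x : (UnitaryGroup.cmDatum L 3 (Matrix.of fun i j : Fin 3 => if i.val + j.val + 1 = 3 then (1 : L) else 0)).Local v),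
    BorelSpace ((UnitaryGroup.cmDatum L 3 (Matrix.of fun i j : Fin 3 => if i.val + j.val + 1 = 3 then (1 : L) else 0)).Local v ⧸
      Subgroup.centralizer ({x} : Set ((UnitaryGroup.cmDatum L 3 (Matrix.of fun i j : Fin 3 => if i.val + j.val + 1 = 3 then (1 : L) else 0)).Local v)))]
  [∀ a : UnitaryGroup.arch (↥(maximalRealSubfield L)) L (IsCMField.complexConj L) 3 H,
    MeasurableSpace (UnitaryGroup.arch (↥(maximalRealSubfield L)) L (IsCMField.complexConj L) 3 H ⧸
      Subgroup.centralizer ({a} : Set (UnitaryGroup.arch (↥(maximalRealSubfield L)) L (IsCMField.complexConj L) 3 H)))]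
  [∀ a : UnitaryGroup.arch (↥(maximalRealSubfield L)) L (IsCMField.complexConj L) 3 H,
    BorelSpace (UnitaryGroup.arch (↥(maximalRealSubfield L)) L (IsCMField.complexConj L) 3 H ⧸
      Subgroup.centralizer ({a} : Set (UnitaryGroup.arch (↥(maximalRealSubfield L)) L (IsCMField.complexConj L) 3 H)))]
  [∀ a : UnitaryGroup.arch (↥(maximalRealSubfield L)) L (IsCMField.complexConj L) 3 (Matrix.of fun i j : Fin 3 => if i.val + j.val + 1 = 3 then (1 : L) else 0),
    MeasurableSpace (UnitaryGroup.arch (↥(maximalRealSubfield L)) L (IsCMField.complexConj L) 3 (Matrix.of fun i j : Fin 3 => if i.val + j.val + 1 = 3 then (1 : L) else 0) ⧸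
      Subgroup.centralizer ({a} : Set (UnitaryGroup.arch (↥(maximalRealSubfield L)) L (IsCMField.complexConj L) 3 (Matrix.of fun i j : Fin 3 => if i.val + j.val + 1 = 3 then (1 : L) else 0))))]
  [∀ a : UnitaryGroup.arch (↥(maximalRealSubfield L)) L (IsCMField.complexConj L) 3 (Matrix.of fun i j : Fin 3 => if i.val + j.val + 1 = 3 then (1 : L) else 0),
    BorelSpace (UnitaryGroup.arch (↥(maximalRealSubfield L)) L (IsCMField.complexConj L) 3 (Matrix.of fun i j : Fin 3 => if i.val + j.val + 1 = 3 then (1 : L) else 0) ⧸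
      Subgroup.centralizer ({a} : Set (UnitaryGroup.arch (↥(maximalRealSubfield L)) L (IsCMField.complexConj L) 3 (Matrix.of fun i j : Fin 3 => if i.val + j.val + 1 = 3 then (1 : L) else 0))))]
  [∀ g : (UnitaryGroup.cmDatum L 3 H).Adelic,
    MeasurableSpace ((UnitaryGroup.cmDatum L 3 H).Adelic ⧸ Subgroup.centralizer ({g} : Set (UnitaryGroup.cmDatum L 3 H).Adelic))]
  [∀ g : (UnitaryGroup.cmDatum L 3 H).Adelic,
    BorelSpace ((UnitaryGroup.cmDatum L 3 H).Adelic ⧸ Subgroup.centralizer ({g} : Set (UnitaryGroup.cmDatum L 3 H).Adelic))]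
  [∀ g : (UnitaryGroup.cmDatum L 3 (Matrix.of fun i j : Fin 3 => if i.val + j.val + 1 = 3 then (1 : L) else 0)).Adelic,
    MeasurableSpace ((UnitaryGroup.cmDatum L 3 (Matrix.of fun i j : Fin 3 => if i.val + j.val + 1 = 3 then (1 : L) else 0)).Adelic ⧸
      Subgroup.centralizer ({g} : Set (UnitaryGroup.cmDatum L 3 (Matrix.of fun i j : Fin 3 => if i.val + j.val + 1 = 3 then (1 : L) else 0)).Adelic))]
  [∀ g : (UnitaryGroup.cmDatum L 3 (Matrix.of fun i j : Fin 3 => if i.val + j.val + 1 = 3 then (1 : L) else 0)).Adelic,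
    BorelSpace ((UnitaryGroup.cmDatum L 3 (Matrix.of fun i j : Fin 3 => if i.val + j.val + 1 = 3 then (1 : L) else 0)).Adelic ⧸
      Subgroup.centralizer ({g} : Set (UnitaryGroup.cmDatum L 3 (Matrix.of fun i j : Fin 3 => if i.val + j.val + 1 = 3 then (1 : L) else 0)).Adelic))]


set_option maxHeartbeats 400000 in
/-- **THE WEIGHT-PARAMETRIC SINGULAR st-HALF OF THE INNER-FORM TRANSFER IDENTITY** (O7 row (SA-st-w); print's SIGNED st-half [Lemma 14.5.2 (b) +
(14.2.1) + (4.1.2)] once the weights are the Kottwitz signs `e_𝐀′ ∕ e_𝐀` of ★ `KottwitzSignCM`).  Data as in ★ (SA-st)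
`adelicStableOrbitalSum_classesSelf_eq_adelicStableOrbitalIntegralG_of_mul_sub_eq_zero` (split semisimple `γ₀`, rational correspondent `γ`, class-preserving
`ψ_v`, `mq v = (ψ_v)_* (mG v)`, kit-side admissibility ∕ normalisation binders, `IsTest` tensors with `T′_v = T_v ∘ ψ_v⁻¹`) PLUS class weights on both
sides: `w′ = warch′ · ∏ᶠ wloc′` on `𝒞′_𝐀(γ₀) ⊂ ConjClasses U(H)(𝐀)` and `w = warch · ∏ᶠ wloc` on `𝒞_𝐀(γ₀) ⊂ ConjClasses U(Φ₃)(𝐀)`, EULER on the carriers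
(`hwE′`, `hwE`), trivial at almost every local base point (`hw1′`, `hw1`), MATCHING along `ψ_v` (`hwψ`), and the one archimedean equation in weighted form
`harchW : Σ_{x ∼ γ₀ ⊗ 1} warch′[x] Φ′_∞(x, T_∞) = Σ_{y ∼ γ ⊗ 1} warch[y] Φ_∞(y, T′_∞)` (PRINTED when the weights are the signs: the signed (14.2.1) at `∞`).
THEN `Σ_{c ∈ 𝒞′_𝐀(γ₀)} w′(c) Φ_𝐀(c; ofLocalAdelic mG mGi; T) = Σ_{c ∈ 𝒞_𝐀(γ₀)} w(c) Φ_𝐀(c; ofLocalAdelic mq mqi; T′)` — ★ (ζ3) glue on the class-weighted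
functions, Euler forms by §2∕§3, finite places by §4. [cite: Rogawski1990, §14.2 (14.2.1) p. 232; §14.5 Lemma 14.5.2 (b) pp. 238–239; §4.1 (4.1.2) p. 40;
§5.4 (5.4.3) pp. 72–73] [cite: Kottwitz1986, Prop. 7.1, Cor. 7.3] -/
theorem adelicKappaOrbitalSum_classesSelf_eq_adelicKappaOrbitalIntegralG_of_mul_sub_eq_zero
    (hH : (H.map (cmConjRingHom L))ᵀ = H) (hHd : H.det ≠ 0)
    {a b : L} (hab : a ≠ b)
    (hγab : ((((γ₀ : unitaryGroup (cmConjRingHom L) H).val : GL (Fin 3) L).val : Matrix (Fin 3) (Fin 3) L) - a • (1 : Matrix (Fin 3) (Fin 3) L)) *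
      ((((γ₀ : unitaryGroup (cmConjRingHom L) H).val : GL (Fin 3) L).val : Matrix (Fin 3) (Fin 3) L) - b • (1 : Matrix (Fin 3) (Fin 3) L)) = 0)
    (hγ : Corresponds (cmConjRingHom L) H (Matrix.of fun i j : Fin 3 => if i.val + j.val + 1 = 3 then (1 : L) else 0) γ₀ γ)
    (ψ : ∀ v : HeightOneSpectrum (𝓞 ↥(maximalRealSubfield L)),
      (UnitaryGroup.cmDatum L 3 H).Local v ≃ₜ* (UnitaryGroup.cmDatum L 3 (Matrix.of fun i j : Fin 3 => if i.val + j.val + 1 = 3 then (1 : L) else 0)).Local v)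
    (hcl : ∀ v (γ' : (UnitaryGroup.cmDatum L 3 H).Local v),
      Corresponds (UnitaryGroup.conjLocal L (IsCMField.complexConj L) v) ((UnitaryGroup.adelicForm L 3 H).map (UnitaryGroup.adeleToLocal L v))
        ((UnitaryGroup.adelicForm L 3 (Matrix.of fun i j : Fin 3 => if i.val + j.val + 1 = 3 then (1 : L) else 0)).map (UnitaryGroup.adeleToLocal L v))
        γ' (ψ v γ'))
    (mG : ∀ v : HeightOneSpectrum (𝓞 ↥(maximalRealSubfield L)), OrbitalMeasureFamily ((UnitaryGroup.cmDatum L 3 H).Local v))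
    (mGi : OrbitalMeasureFamily (UnitaryGroup.arch (↥(maximalRealSubfield L)) L (IsCMField.complexConj L) 3 H))
    (mq : ∀ v : HeightOneSpectrum (𝓞 ↥(maximalRealSubfield L)),
      OrbitalMeasureFamily ((UnitaryGroup.cmDatum L 3 (Matrix.of fun i j : Fin 3 => if i.val + j.val + 1 = 3 then (1 : L) else 0)).Local v))
    (hmq : ∀ v, mq v = (mG v).transport (ψ v).toMulEquiv (ψ v).continuous (ψ v).symm.continuous)
    (mqi : OrbitalMeasureFamily (UnitaryGroup.arch (↥(maximalRealSubfield L)) L (IsCMField.complexConj L) 3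
      (Matrix.of fun i j : Fin 3 => if i.val + j.val + 1 = 3 then (1 : L) else 0)))
    -- kit-side binders on the inner form `G′ = U(H)`
    (hadm' : ∀ v, (mG v).IsAdmissibleOn fun x : (UnitaryGroup.cmDatum L 3 H).Local v =>
      Corresponds (UnitaryGroup.conjLocal L (IsCMField.complexConj L) v)
        ((UnitaryGroup.adelicForm L 3 H).map (UnitaryGroup.adeleToLocal L v))
        ((UnitaryGroup.adelicForm L 3 H).map (UnitaryGroup.adeleToLocal L v))
        ((UnitaryGroup.cmDatum L 3 H).toLocal v ((UnitaryGroup.cmDatum L 3 H).toAdelic γ₀)) x)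
    (hadmA' : mGi.IsAdmissibleOn fun x : UnitaryGroup.arch (↥(maximalRealSubfield L)) L (IsCMField.complexConj L) 3 H =>
      Corresponds (UnitaryGroup.conjMixed (↥(maximalRealSubfield L)) L (IsCMField.complexConj L)) (UnitaryGroup.archFormOf L 3 H)
        (UnitaryGroup.archFormOf L 3 H) (cmRationalToArch L 3 H γ₀) x)
    (hnormγ' : ∃ S₀ : Finset (HeightOneSpectrum (𝓞 ↥(maximalRealSubfield L))),
      UnitaryGroup.IsNormalisedOff L 3 H mG ((UnitaryGroup.cmDatum L 3 H).toAdelic γ₀) S₀)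
    (hnorm' : ∀ p : MatchingAdeleG₂ L H H γ₀, ∃ S₀ : Finset (HeightOneSpectrum (𝓞 ↥(maximalRealSubfield L))),
      UnitaryGroup.IsNormalisedOff L 3 H mG p.adele S₀)
    -- kit-side binders on the quasi-split form `G = U(Φ₃)` at the family `mq`
    (hadm : ∀ v, (mq v).IsAdmissibleOn fun x : (UnitaryGroup.cmDatum L 3 (Matrix.of fun i j : Fin 3 => if i.val + j.val + 1 = 3 then (1 : L) else 0)).Local v =>
      Corresponds (UnitaryGroup.conjLocal L (IsCMField.complexConj L) v)
        ((UnitaryGroup.adelicForm L 3 H).map (UnitaryGroup.adeleToLocal L v))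
        ((UnitaryGroup.adelicForm L 3 (Matrix.of fun i j : Fin 3 => if i.val + j.val + 1 = 3 then (1 : L) else 0)).map (UnitaryGroup.adeleToLocal L v))
        ((UnitaryGroup.cmDatum L 3 H).toLocal v ((UnitaryGroup.cmDatum L 3 H).toAdelic γ₀)) x)
    (hadmA : mqi.IsAdmissibleOn fun x : UnitaryGroup.arch (↥(maximalRealSubfield L)) L (IsCMField.complexConj L) 3
        (Matrix.of fun i j : Fin 3 => if i.val + j.val + 1 = 3 then (1 : L) else 0) =>
      Corresponds (UnitaryGroup.conjMixed (↥(maximalRealSubfield L)) L (IsCMField.complexConj L)) (UnitaryGroup.archFormOf L 3 H)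
        (UnitaryGroup.archFormOf L 3 (Matrix.of fun i j : Fin 3 => if i.val + j.val + 1 = 3 then (1 : L) else 0)) (cmRationalToArch L 3 H γ₀) x)
    (hnormγ : ∃ S₀ : Finset (HeightOneSpectrum (𝓞 ↥(maximalRealSubfield L))),
      UnitaryGroup.IsNormalisedOff L 3 (Matrix.of fun i j : Fin 3 => if i.val + j.val + 1 = 3 then (1 : L) else 0) mq
        ((UnitaryGroup.cmDatum L 3 (Matrix.of fun i j : Fin 3 => if i.val + j.val + 1 = 3 then (1 : L) else 0)).toAdelic γ) S₀)
    (hnorm : ∀ p : MatchingAdeleG L H γ₀, ∃ S₀ : Finset (HeightOneSpectrum (𝓞 ↥(maximalRealSubfield L))),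
      UnitaryGroup.IsNormalisedOff L 3 (Matrix.of fun i j : Fin 3 => if i.val + j.val + 1 = 3 then (1 : L) else 0) mq p.adele S₀)
    -- the test data
    (T : UnitaryGroup.PureTensor L 3 H) (hT : T.IsTest)
    (T' : UnitaryGroup.PureTensor L 3 (Matrix.of fun i j : Fin 3 => if i.val + j.val + 1 = 3 then (1 : L) else 0)) (hT' : T'.IsTest)
    (hloc : ∀ v, T'.loc v = T.loc v ∘ (ψ v).symm)
    -- the class weights on the inner form …
    (w' : ConjClasses (UnitaryGroup.cmDatum L 3 H).Adelic → ℂ)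
    (wloc' : ∀ v : HeightOneSpectrum (𝓞 ↥(maximalRealSubfield L)), ConjClasses ((UnitaryGroup.cmDatum L 3 H).Local v) → ℂ)
    (warch' : ConjClasses (UnitaryGroup.arch (↥(maximalRealSubfield L)) L (IsCMField.complexConj L) 3 H) → ℂ)
    (hwE' : ∀ c ∈ MatchingAdeleG₂.classes L H H γ₀, ∃ Sw : Finset (HeightOneSpectrum (𝓞 ↥(maximalRealSubfield L))),
      (∀ v ∉ Sw, wloc' v (ConjClasses.mk ((UnitaryGroup.cmDatum L 3 H).toLocal v (Quotient.out c))) = 1) ∧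
      w' c = warch' (ConjClasses.mk (UnitaryGroup.archPart (↥(maximalRealSubfield L)) L (IsCMField.complexConj L) 3 H (Quotient.out c))) *
        ∏ v ∈ Sw, wloc' v (ConjClasses.mk ((UnitaryGroup.cmDatum L 3 H).toLocal v (Quotient.out c))))
    (hw1' : ∀ᶠ v in cofinite, wloc' v (ConjClasses.mk ((UnitaryGroup.cmDatum L 3 H).toLocal v ((UnitaryGroup.cmDatum L 3 H).toAdelic γ₀))) = 1)
    -- … and on the quasi-split form
    (w : ConjClasses (UnitaryGroup.cmDatum L 3 (Matrix.of fun i j : Fin 3 => if i.val + j.val + 1 = 3 then (1 : L) else 0)).Adelic → ℂ)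
    (wloc : ∀ v : HeightOneSpectrum (𝓞 ↥(maximalRealSubfield L)), ConjClasses ((UnitaryGroup.cmDatum L 3 (Matrix.of fun i j : Fin 3 => if i.val + j.val + 1 = 3 then (1 : L) else 0)).Local v) → ℂ)
    (warch : ConjClasses (UnitaryGroup.arch (↥(maximalRealSubfield L)) L (IsCMField.complexConj L) 3 (Matrix.of fun i j : Fin 3 => if i.val + j.val + 1 = 3 then (1 : L) else 0)) → ℂ)
    (hwE : ∀ c ∈ MatchingAdeleG.classes L H γ₀, ∃ Sw : Finset (HeightOneSpectrum (𝓞 ↥(maximalRealSubfield L))),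
      (∀ v ∉ Sw, wloc v (ConjClasses.mk ((UnitaryGroup.cmDatum L 3 (Matrix.of fun i j : Fin 3 => if i.val + j.val + 1 = 3 then (1 : L) else 0)).toLocal v (Quotient.out c))) = 1) ∧
      w c = warch (ConjClasses.mk (UnitaryGroup.archPart (↥(maximalRealSubfield L)) L (IsCMField.complexConj L) 3 (Matrix.of fun i j : Fin 3 => if i.val + j.val + 1 = 3 then (1 : L) else 0) (Quotient.out c))) *
        ∏ v ∈ Sw, wloc v (ConjClasses.mk ((UnitaryGroup.cmDatum L 3 (Matrix.of fun i j : Fin 3 => if i.val + j.val + 1 = 3 then (1 : L) else 0)).toLocal v (Quotient.out c))))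
    (hw1 : ∀ᶠ v in cofinite, wloc v (ConjClasses.mk ((UnitaryGroup.cmDatum L 3 (Matrix.of fun i j : Fin 3 => if i.val + j.val + 1 = 3 then (1 : L) else 0)).toLocal v ((UnitaryGroup.cmDatum L 3 (Matrix.of fun i j : Fin 3 => if i.val + j.val + 1 = 3 then (1 : L) else 0)).toAdelic γ))) = 1)
    -- the weights match along `ψ_v`, and the weighted archimedean equation
    (hwψ : ∀ v x, wloc v (ConjClasses.mk (ψ v x)) = wloc' v (ConjClasses.mk x))
    (harchW : archStableOrbitalIntegral L 3 H mGi (fun x => warch' (ConjClasses.mk x) * T.arch x) (cmRationalToArch L 3 H γ₀) =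
      archStableOrbitalIntegral L 3 (Matrix.of fun i j : Fin 3 => if i.val + j.val + 1 = 3 then (1 : L) else 0) mqi (fun y => warch (ConjClasses.mk y) * T'.arch y)
        (cmRationalToArch L 3 (Matrix.of fun i j : Fin 3 => if i.val + j.val + 1 = 3 then (1 : L) else 0) γ)) :
    adelicKappaOrbitalSum (MatchingAdeleG₂.classes L H H γ₀) w' (UnitaryGroup.OrbitalMeasureFamily.ofLocalAdelic L 3 H mG mGi) T.eval =
      adelicKappaOrbitalIntegralG L H γ₀ w
        (UnitaryGroup.OrbitalMeasureFamily.ofLocalAdelic L 3 (Matrix.of fun i j : Fin 3 => if i.val + j.val + 1 = 3 then (1 : L) else 0) mq mqi) T'.eval := by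
  -- finite places: weighted (ζ2) at every `v`
  have hlocW : ∀ v, localStableOrbitalIntegral L 3 H v (mG v) (fun x => wloc' v (ConjClasses.mk x) * T.loc v x)
        ((UnitaryGroup.cmDatum L 3 H).toLocal v ((UnitaryGroup.cmDatum L 3 H).toAdelic γ₀)) =
      localStableOrbitalIntegral L 3 (Matrix.of fun i j : Fin 3 => if i.val + j.val + 1 = 3 then (1 : L) else 0) v
        ((mG v).transport (ψ v).toMulEquiv (ψ v).continuous (ψ v).symm.continuous) (fun y => wloc v (ConjClasses.mk y) * T'.loc v y)
        ((UnitaryGroup.cmDatum L 3 (Matrix.of fun i j : Fin 3 => if i.val + j.val + 1 = 3 then (1 : L) else 0)).toLocal v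
          ((UnitaryGroup.cmDatum L 3 (Matrix.of fun i j : Fin 3 => if i.val + j.val + 1 = 3 then (1 : L) else 0)).toAdelic γ)) :=
    fun v => localStableOrbitalIntegral_classWeight_base_eq_of_loc_eq_comp_symm v (ψ v) (hcl v) (mG v) (hloc v) hγ (wloc' v) (wloc v) (hwψ v)
  -- the two weighted Euler forms (§2 on the self-carrier at `γ := γ₀`, §3 on the quasi-split carrier at the transported family)
  have hG' := MatchingAdeleG₂.exists_forall_isEulerOnClasses_ofLocalAdelic_classWeight_of_mul_sub_eq_zero hH hHd
    (corresponds_self_iff.2 (IsStablyConj.refl _)) hab hγab mG mGi hadm' hadmA' hnormγ' hnorm' T hT w' wloc' warch' hwE' hw1'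
  have hG := MatchingAdeleG.exists_forall_isEulerOnClasses_ofLocalAdelic_classWeight_of_mul_sub_eq_zero hγ hab hγab mq mqi hadm hadmA hnormγ hnorm
    T' hT' w wloc warch hwE hw1
  simp only [hmq] at hG
  -- (ζ3) glue on the class-weighted functions
  have key := adelicStableOrbitalSum_classesSelf_eq_adelicStableOrbitalIntegralG_of_forall_eq (γ₀ := γ₀) (γ := γ) mG
    (fun v => (mG v).transport (ψ v).toMulEquiv (ψ v).continuous (ψ v).symm.continuous) mGi mqi
    (fun v x => wloc' v (ConjClasses.mk x) * T.loc v x) (fun v y => wloc v (ConjClasses.mk y) * T'.loc v y)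
    (fun x => warch' (ConjClasses.mk x) * T.arch x) (fun y => warch (ConjClasses.mk y) * T'.arch y)
    hlocW harchW
    (UnitaryGroup.OrbitalMeasureFamily.ofLocalAdelic L 3 H mG mGi) (fun x => w' (ConjClasses.mk x) * T.eval x)
    (UnitaryGroup.OrbitalMeasureFamily.ofLocalAdelic L 3 (Matrix.of fun i j : Fin 3 => if i.val + j.val + 1 = 3 then (1 : L) else 0) mq mqi)
    (fun x => w (ConjClasses.mk x) * T'.eval x) hG' ?_
  · rw [adelicStableOrbitalIntegralG] at key
    rw [adelicKappaOrbitalIntegralG, adelicKappaOrbitalSum_eq_adelicStableOrbitalSum_classWeight_mul,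
      adelicKappaOrbitalSum_eq_adelicStableOrbitalSum_classWeight_mul]
    exact key
  · simpa only [hmq] using hG

end StHalfW

end Literature.NumberTheory.Rogawski1990

end
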